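import Mathlib.NumberTheory.ModularForms.EisensteinSeries.E2.Summable
import Mathlib.NumberTheory.ModularForms.EisensteinSeries.E2.Transform
import Mathlib.NumberTheory.ModularForms.EisensteinSeries.E2.MDifferentiable
import Mathlib.NumberTheory.ModularForms.LevelOne.Basic
import Mathlib.NumberTheory.Modular
import Mathlib.NumberTheory.ModularForms.Discriminant
import Mathlib.NumberTheory.ModularForms.EisensteinSeries.Basic
import HarnessLib

/-!
# Functions of moderate growth on the upper half-plane (the class `𝓟` of CKMRV §4.1)

Cohn–Kumar–Miller–Radchenko–Viazovska, *Universal optimality of the `E₈` and Leech lattices and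
interpolation formulas*, Ann. of Math. 196 (2022) = arXiv:1902.05438, §4.1: "those satisfying a
bound of the form (4.1) `|F(τ)| ≤ α(Im(τ)^{−β} + |τ|^γ)` for some `α, β, γ ≥ 0`. … Following Knopp's
notation, let `𝓟 = {F : ℍ → ℂ : F is holomorphic and satisfies (4.1) for all τ ∈ ℍ}` denote the
space of holomorphic functions having moderate growth on the full upper half-plane." And
(Lemma 4.1): "In particular, `𝓟` is preserved by the slash operation."

This file vendors the DEFINITIONS `HasModerateGrowth` ((4.1), verbatim) and `IsClassP` (`𝓟`),
and PROVES:

* the equivalent product form `‖F τ‖ ≤ C (max(Im τ⁻¹, 1) · max(|τ|, 1))ᴺ`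
  (`hasModerateGrowth_iff`), from which the algebra properties follow: constants, `τ ↦ τ`, sums,
  products, scalar multiples (`HasModerateGrowth.add/mul/smul/…`);
* **stability under the weight-`k` slash action of `SL₂(ℤ)`** (`HasModerateGrowth.slash`,
  `IsClassP.slash`; the case of Lemma 4.1 used in the paper), via the generators `S`, `T`;
* **every level-one modular form has moderate growth** (`hasModerateGrowth_of_modularForm`:
  `‖f(τ)‖ ≤ M (1 + Im(τ)^{−k})`, by reduction to `Im ≥ 1/2`), in particular `E₄, E₆, Δ ∈ 𝓟`;
* **`E₂ ∈ 𝓟`** (`isClassP_E2`), from Mathlib's transformation law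
  `E₂|₂γ = E₂ − (2ζ(2))⁻¹ · 2πi c/(cτ+d)`.

(CKMRV: "(4.1) … is satisfied by … the classical modular forms `E_k` and theta functions from
Section 2.1"; the theta forms `U, V, W` are treated in the sequel importing
`JacobiThetaGammaTwo.lean`.)

## References

* H. Cohn, A. Kumar, S. D. Miller, D. Radchenko, M. Viazovska, Ann. of Math. 196 (2022),
  arXiv:1902.05438, §4.1, display (4.1) and Lemma 4.1. [CohnEtAl2019]
* M. Knopp, *Some new results on the Eichler cohomology of automorphic forms*, Bull. AMS 80
  (1974) (the class `𝓟`).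
-/

noncomputable section

open Complex hiding I
open Filter Topology ModularForm SlashInvariantForm
open UpperHalfPlane hiding I
open Complex (I)
open scoped Real MatrixGroups ModularForm Manifold

namespace Literature.NumberTheory.ModularForms

/-! ## The definitions -/

/-- **Moderate growth** (CKMRV (4.1)): `|F(τ)| ≤ α(Im(τ)^{−β} + |τ|^γ)` for all `τ ∈ ℍ`, for some
constants `α` and `β, γ ≥ 0`. [cite: CohnEtAl2019, §4.1 (4.1)] -/
def HasModerateGrowth (F : ℍ → ℂ) : Prop :=
  ∃ α β γ : ℝ, 0 ≤ β ∧ 0 ≤ γ ∧ ∀ τ : ℍ, ‖F τ‖ ≤ α * (τ.im ^ (-β) + ‖(τ : ℂ)‖ ^ γ)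

/-- **The class `𝓟`** (CKMRV (4.3), "following Knopp's notation"): holomorphic functions on `ℍ` of
moderate growth. [cite: CohnEtAl2019, §4.1 (4.3)] -/
structure IsClassP (F : ℍ → ℂ) : Prop where
  mdifferentiable : MDiff F
  hasModerateGrowth : HasModerateGrowth F

/-! ## The growth gauge `max(Im τ⁻¹, 1) · max(|τ|, 1)` -/

/-- The gauge `max(Im τ⁻¹, 1) · max(|τ|, 1) ≥ 1`. [folklore] -/
def growthGauge (τ : ℍ) : ℝ := max τ.im⁻¹ 1 * max ‖(τ : ℂ)‖ 1

/-- `gauge ≥ 1`. [folklore] -/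
theorem one_le_growthGauge (τ : ℍ) : 1 ≤ growthGauge τ :=
  one_le_mul_of_one_le_of_one_le (le_max_right _ _) (le_max_right _ _)

/-- `gauge > 0`. [folklore] -/
theorem growthGauge_pos (τ : ℍ) : 0 < growthGauge τ :=
  zero_lt_one.trans_le (one_le_growthGauge τ)

/-- `max(Im τ⁻¹, 1) ≤ gauge(τ)`. [folklore] -/
theorem max_inv_im_le_growthGauge (τ : ℍ) : max τ.im⁻¹ 1 ≤ growthGauge τ :=
  le_mul_of_one_le_right (zero_le_one.trans (le_max_right _ _)) (le_max_right _ _)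

/-- `max(|τ|, 1) ≤ gauge(τ)`. [folklore] -/
theorem max_norm_le_growthGauge (τ : ℍ) : max ‖(τ : ℂ)‖ 1 ≤ growthGauge τ :=
  le_mul_of_one_le_left (zero_le_one.trans (le_max_right _ _)) (le_max_right _ _)

/-- `Im τ⁻¹ ≤ gauge(τ)`. [folklore] -/
theorem inv_im_le_growthGauge (τ : ℍ) : τ.im⁻¹ ≤ growthGauge τ :=
  (le_max_left _ _).trans (max_inv_im_le_growthGauge τ)

/-- `|τ| ≤ gauge(τ)`. [folklore] -/
theorem norm_coe_le_growthGauge (τ : ℍ) : ‖(τ : ℂ)‖ ≤ growthGauge τ :=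
  (le_max_left _ _).trans (max_norm_le_growthGauge τ)

/-- `Im(τ)^{−β} ≤ gauge(τ)ᴺ` for `0 ≤ β ≤ N`. [folklore] -/
theorem im_rpow_neg_le_growthGauge_pow (τ : ℍ) {β : ℝ} {N : ℕ} (hβ : 0 ≤ β) (hβN : β ≤ N) :
    τ.im ^ (-β) ≤ growthGauge τ ^ N := by
  have h1 : τ.im ^ (-β) = τ.im⁻¹ ^ β := by
    rw [Real.rpow_neg τ.im_pos.le, Real.inv_rpow τ.im_pos.le]
  rw [h1]
  calc τ.im⁻¹ ^ β ≤ (max τ.im⁻¹ 1) ^ β :=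
        Real.rpow_le_rpow (inv_nonneg.2 τ.im_pos.le) (le_max_left _ _) hβ
    _ ≤ (max τ.im⁻¹ 1) ^ (N : ℝ) := Real.rpow_le_rpow_of_exponent_le (le_max_right _ _) hβN
    _ = (max τ.im⁻¹ 1) ^ N := Real.rpow_natCast _ _
    _ ≤ growthGauge τ ^ N :=
        pow_le_pow_left₀ (zero_le_one.trans (le_max_right _ _)) (max_inv_im_le_growthGauge τ) N

/-- `|τ|^γ ≤ gauge(τ)ᴺ` for `0 ≤ γ ≤ N`. [folklore] -/
theorem norm_rpow_le_growthGauge_pow (τ : ℍ) {γ : ℝ} {N : ℕ} (hγ : 0 ≤ γ) (hγN : γ ≤ N) :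
    ‖(τ : ℂ)‖ ^ γ ≤ growthGauge τ ^ N := by
  calc ‖(τ : ℂ)‖ ^ γ ≤ (max ‖(τ : ℂ)‖ 1) ^ γ :=
        Real.rpow_le_rpow (norm_nonneg _) (le_max_left _ _) hγ
    _ ≤ (max ‖(τ : ℂ)‖ 1) ^ (N : ℝ) := Real.rpow_le_rpow_of_exponent_le (le_max_right _ _) hγN
    _ = (max ‖(τ : ℂ)‖ 1) ^ N := Real.rpow_natCast _ _
    _ ≤ growthGauge τ ^ N :=
        pow_le_pow_left₀ (zero_le_one.trans (le_max_right _ _)) (max_norm_le_growthGauge τ) N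

/-- `gauge(τ)ᴺ ≤ (3/2)(Im(τ)^{−2N} + |τ|^{2N})`. [folklore] -/
theorem growthGauge_pow_le (τ : ℍ) (N : ℕ) :
    growthGauge τ ^ N ≤ 3 / 2 * (τ.im ^ (-((2 * N : ℕ) : ℝ)) + ‖(τ : ℂ)‖ ^ ((2 * N : ℕ) : ℝ)) := by
  rw [Real.rpow_natCast, Real.rpow_neg τ.im_pos.le, Real.rpow_natCast, ← inv_pow]
  set a := max τ.im⁻¹ 1
  set b := max ‖(τ : ℂ)‖ 1
  have ha1 : 1 ≤ a := le_max_right _ _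
  have hb1 : 1 ≤ b := le_max_right _ _
  have hy : 0 < τ.im := τ.im_pos
  have hab : growthGauge τ ^ N = a ^ N * b ^ N := mul_pow _ _ _
  have h2 : a ^ N * b ^ N ≤ ((a ^ N) ^ 2 + (b ^ N) ^ 2) / 2 := by
    nlinarith [sq_nonneg (a ^ N - b ^ N)]
  have hapow : (a ^ N) ^ 2 ≤ τ.im⁻¹ ^ (2 * N) + 1 := by
    rw [← pow_mul, mul_comm]
    rcases le_total τ.im⁻¹ 1 with h | h
    · have : a = 1 := max_eq_right h
      rw [this, one_pow]
      linarith [pow_nonneg (inv_nonneg.2 hy.le) (2 * N)]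
    · have : a = τ.im⁻¹ := max_eq_left h
      rw [this]
      linarith
  have hbpow : (b ^ N) ^ 2 ≤ ‖(τ : ℂ)‖ ^ (2 * N) + 1 := by
    rw [← pow_mul, mul_comm]
    rcases le_total ‖(τ : ℂ)‖ 1 with h | h
    · have : b = 1 := max_eq_right h
      rw [this, one_pow]
      linarith [pow_nonneg (norm_nonneg (τ : ℂ)) (2 * N)]
    · have : b = ‖(τ : ℂ)‖ := max_eq_left h
      rw [this]
      linarith
  have hone : 1 ≤ τ.im⁻¹ ^ (2 * N) + ‖(τ : ℂ)‖ ^ (2 * N) := by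
    rcases le_total τ.im 1 with h | h
    · have h1 : 1 ≤ τ.im⁻¹ := (one_le_inv₀ hy).2 h
      linarith [one_le_pow₀ (n := 2 * N) h1, pow_nonneg (norm_nonneg (τ : ℂ)) (2 * N)]
    · have h1 : 1 ≤ ‖(τ : ℂ)‖ := h.trans ((le_abs_self _).trans (abs_im_le_norm (τ : ℂ)))
      linarith [one_le_pow₀ (n := 2 * N) h1, pow_nonneg (inv_nonneg.2 hy.le) (2 * N)]
  rw [hab]
  linarith

/-! ## The product form of moderate growth -/

/-- **Moderate growth ⇔ `‖F τ‖ ≤ C · gauge(τ)ᴺ`.** [folklore] -/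
theorem hasModerateGrowth_iff {F : ℍ → ℂ} :
    HasModerateGrowth F ↔ ∃ (C : ℝ) (N : ℕ), ∀ τ : ℍ, ‖F τ‖ ≤ C * growthGauge τ ^ N := by
  constructor
  · rintro ⟨α, β, γ, hβ, hγ, h⟩
    refine ⟨2 * |α|, ⌈max β γ⌉₊, fun τ => ?_⟩
    have hN : max β γ ≤ (⌈max β γ⌉₊ : ℝ) := Nat.le_ceil _
    have h1 := im_rpow_neg_le_growthGauge_pow τ hβ ((le_max_left β γ).trans hN)
    have h2 := norm_rpow_le_growthGauge_pow τ hγ ((le_max_right β γ).trans hN)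
    have hsum : 0 ≤ τ.im ^ (-β) + ‖(τ : ℂ)‖ ^ γ :=
      add_nonneg (Real.rpow_nonneg τ.im_pos.le _) (Real.rpow_nonneg (norm_nonneg _) _)
    calc ‖F τ‖ ≤ α * (τ.im ^ (-β) + ‖(τ : ℂ)‖ ^ γ) := h τ
      _ ≤ |α| * (τ.im ^ (-β) + ‖(τ : ℂ)‖ ^ γ) :=
          mul_le_mul_of_nonneg_right (le_abs_self α) hsum
      _ ≤ |α| * (growthGauge τ ^ ⌈max β γ⌉₊ + growthGauge τ ^ ⌈max β γ⌉₊) :=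
          mul_le_mul_of_nonneg_left (add_le_add h1 h2) (abs_nonneg α)
      _ = 2 * |α| * growthGauge τ ^ ⌈max β γ⌉₊ := by ring
  · rintro ⟨C, N, h⟩
    refine ⟨3 / 2 * |C|, (2 * N : ℕ), (2 * N : ℕ), by positivity, by positivity, fun τ => ?_⟩
    have hg := growthGauge_pow_le τ N
    have hg0 : 0 ≤ growthGauge τ ^ N := pow_nonneg (growthGauge_pos τ).le N
    calc ‖F τ‖ ≤ C * growthGauge τ ^ N := h τ
      _ ≤ |C| * growthGauge τ ^ N := mul_le_mul_of_nonneg_right (le_abs_self C) hg0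
      _ ≤ |C| * (3 / 2 * (τ.im ^ (-((2 * N : ℕ) : ℝ)) + ‖(τ : ℂ)‖ ^ ((2 * N : ℕ) : ℝ))) :=
          mul_le_mul_of_nonneg_left hg (abs_nonneg C)
      _ = _ := by ring

/-- A bound `‖F τ‖ ≤ C · gauge(τ)ᴺ` gives moderate growth. [folklore] -/
theorem hasModerateGrowth_of_le {F : ℍ → ℂ} (C : ℝ) (N : ℕ)
    (h : ∀ τ : ℍ, ‖F τ‖ ≤ C * growthGauge τ ^ N) : HasModerateGrowth F :=
  hasModerateGrowth_iff.2 ⟨C, N, h⟩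

/-- The product-form bound, with a nonnegative constant. [folklore] -/
theorem HasModerateGrowth.exists_bound {F : ℍ → ℂ} (hF : HasModerateGrowth F) :
    ∃ (C : ℝ) (N : ℕ), 0 ≤ C ∧ ∀ τ : ℍ, ‖F τ‖ ≤ C * growthGauge τ ^ N := by
  obtain ⟨C, N, h⟩ := hasModerateGrowth_iff.1 hF
  exact ⟨|C|, N, abs_nonneg C, fun τ =>
    (h τ).trans (mul_le_mul_of_nonneg_right (le_abs_self C) (pow_nonneg (growthGauge_pos τ).le N))⟩

/-! ## Algebra -/

namespace HasModerateGrowth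

variable {F G : ℍ → ℂ}

/-- Domination: `‖F‖ ≤ c‖G‖` pointwise and `G` of moderate growth ⇒ `F` of moderate growth.
[folklore] -/
theorem of_norm_le (hG : HasModerateGrowth G) (c : ℝ) (h : ∀ τ, ‖F τ‖ ≤ c * ‖G τ‖) :
    HasModerateGrowth F := by
  obtain ⟨C, N, hC, hG⟩ := hG.exists_bound
  refine hasModerateGrowth_of_le (|c| * C) N fun τ => (h τ).trans ?_
  calc c * ‖G τ‖ ≤ |c| * ‖G τ‖ := mul_le_mul_of_nonneg_right (le_abs_self c) (norm_nonneg _)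
    _ ≤ |c| * (C * growthGauge τ ^ N) := mul_le_mul_of_nonneg_left (hG τ) (abs_nonneg c)
    _ = |c| * C * growthGauge τ ^ N := by ring

/-- Sums of functions of moderate growth have moderate growth. [folklore] -/
theorem add (hF : HasModerateGrowth F) (hG : HasModerateGrowth G) : HasModerateGrowth (F + G) := by
  obtain ⟨C, N, hC, hF⟩ := hF.exists_bound
  obtain ⟨D, M, hD, hG⟩ := hG.exists_bound
  refine hasModerateGrowth_of_le (C + D) (max N M) fun τ => ?_
  have h1 := one_le_growthGauge τ
  calc ‖(F + G) τ‖ ≤ ‖F τ‖ + ‖G τ‖ := norm_add_le _ _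
    _ ≤ C * growthGauge τ ^ N + D * growthGauge τ ^ M := add_le_add (hF τ) (hG τ)
    _ ≤ C * growthGauge τ ^ max N M + D * growthGauge τ ^ max N M :=
        add_le_add (mul_le_mul_of_nonneg_left (pow_le_pow_right₀ h1 (le_max_left _ _)) hC)
          (mul_le_mul_of_nonneg_left (pow_le_pow_right₀ h1 (le_max_right _ _)) hD)
    _ = (C + D) * growthGauge τ ^ max N M := by ring

/-- `−F`. [folklore] -/
theorem neg (hF : HasModerateGrowth F) : HasModerateGrowth (-F) :=
  hF.of_norm_le 1 fun τ => by simp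

/-- Differences. [folklore] -/
theorem sub (hF : HasModerateGrowth F) (hG : HasModerateGrowth G) : HasModerateGrowth (F - G) := by
  rw [sub_eq_add_neg]; exact hF.add hG.neg

/-- Products of functions of moderate growth have moderate growth. [folklore] -/
theorem mul (hF : HasModerateGrowth F) (hG : HasModerateGrowth G) : HasModerateGrowth (F * G) := by
  obtain ⟨C, N, hC, hF⟩ := hF.exists_bound
  obtain ⟨D, M, hD, hG⟩ := hG.exists_bound
  refine hasModerateGrowth_of_le (C * D) (N + M) fun τ => ?_
  calc ‖(F * G) τ‖ = ‖F τ‖ * ‖G τ‖ := norm_mul _ _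
    _ ≤ (C * growthGauge τ ^ N) * (D * growthGauge τ ^ M) :=
        mul_le_mul (hF τ) (hG τ) (norm_nonneg _) ((norm_nonneg _).trans (hF τ))
    _ = C * D * growthGauge τ ^ (N + M) := by rw [pow_add]; ring

/-- Constant multiples. [folklore] -/
theorem const_mul (hF : HasModerateGrowth F) (c : ℂ) : HasModerateGrowth (fun τ => c * F τ) :=
  hF.of_norm_le ‖c‖ fun τ => by rw [norm_mul]

/-- Scalar multiples. [folklore] -/
theorem smul (hF : HasModerateGrowth F) (c : ℂ) : HasModerateGrowth (c • F) :=
  hF.const_mul c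

/-- Powers. [folklore] -/
theorem pow (hF : HasModerateGrowth F) : ∀ n : ℕ, HasModerateGrowth (F ^ n)
  | 0 => by
    refine hasModerateGrowth_of_le 1 0 fun τ => ?_
    simp
  | n + 1 => by rw [pow_succ]; exact (hF.pow n).mul hF

/-- Finite sums. [folklore] -/
theorem sum {ι : Type*} (s : Finset ι) {F : ι → ℍ → ℂ} (h : ∀ i ∈ s, HasModerateGrowth (F i)) :
    HasModerateGrowth (∑ i ∈ s, F i) := by
  classical
  induction s using Finset.induction_on with
  | empty =>
    refine hasModerateGrowth_of_le 0 0 fun τ => ?_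
    simp
  | insert i s hi ih =>
    rw [Finset.sum_insert hi]
    exact (h i (Finset.mem_insert_self i s)).add (ih fun j hj => h j (Finset.mem_insert_of_mem hj))

end HasModerateGrowth

/-- Constants have moderate growth. [folklore] -/
theorem hasModerateGrowth_const (c : ℂ) : HasModerateGrowth fun _ : ℍ => c :=
  hasModerateGrowth_of_le ‖c‖ 0 fun τ => by simp

/-- `0` has moderate growth. [folklore] -/
theorem hasModerateGrowth_zero : HasModerateGrowth (0 : ℍ → ℂ) := hasModerateGrowth_const 0

/-- `τ ↦ τ` has moderate growth (`φ₋₂(τ) = τ` of CKMRV Prop. 4.2). [folklore] -/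
theorem hasModerateGrowth_coe : HasModerateGrowth fun τ : ℍ => (τ : ℂ) :=
  hasModerateGrowth_of_le 1 1 fun τ => by simpa using norm_coe_le_growthGauge τ

/-- Constants are in `𝓟`. [folklore] -/
theorem isClassP_const (c : ℂ) : IsClassP fun _ : ℍ => c :=
  ⟨mdifferentiable_const, hasModerateGrowth_const c⟩

/-- `τ ↦ τ` is in `𝓟`. [folklore] -/
theorem isClassP_coe : IsClassP fun τ : ℍ => (τ : ℂ) :=
  ⟨UpperHalfPlane.mdifferentiable_coe, hasModerateGrowth_coe⟩

namespace IsClassP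

variable {F G : ℍ → ℂ}

/-- `𝓟` is closed under addition. [folklore] -/
theorem add (hF : IsClassP F) (hG : IsClassP G) : IsClassP (F + G) :=
  ⟨hF.1.add hG.1, hF.2.add hG.2⟩

/-- `𝓟` is closed under negation. [folklore] -/
theorem neg (hF : IsClassP F) : IsClassP (-F) := ⟨hF.1.neg, hF.2.neg⟩

/-- `𝓟` is closed under subtraction. [folklore] -/
theorem sub (hF : IsClassP F) (hG : IsClassP G) : IsClassP (F - G) :=
  ⟨hF.1.sub hG.1, hF.2.sub hG.2⟩

/-- `𝓟` is closed under multiplication (an algebra). [folklore] -/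
theorem mul (hF : IsClassP F) (hG : IsClassP G) : IsClassP (F * G) :=
  ⟨hF.1.mul hG.1, hF.2.mul hG.2⟩

/-- `𝓟` is closed under scalars. [folklore] -/
theorem smul (hF : IsClassP F) (c : ℂ) : IsClassP (c • F) :=
  ⟨hF.1.const_smul c, hF.2.smul c⟩

/-- `𝓟` is closed under powers. [folklore] -/
theorem pow (hF : IsClassP F) (n : ℕ) : IsClassP (F ^ n) := ⟨hF.1.pow n, hF.2.pow n⟩

end IsClassP

/-! ## Stability under the slash action of `SL₂(ℤ)` (CKMRV Lemma 4.1, special case) -/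

/-- The gauge under a real translation: `gauge(τ + x) ≤ (1 + |x|) gauge(τ)`. [folklore] -/
theorem growthGauge_vadd_le (x : ℝ) (τ : ℍ) :
    growthGauge ((x +ᵥ τ : ℍ)) ≤ (1 + |x|) * growthGauge τ := by
  unfold growthGauge
  rw [vadd_im, coe_vadd]
  have hb1 : (1 : ℝ) ≤ max ‖(τ : ℂ)‖ 1 := le_max_right _ _
  have ha0 : 0 ≤ max τ.im⁻¹ 1 := zero_le_one.trans (le_max_right _ _)
  have hx : ‖((x : ℂ) + τ)‖ ≤ (1 + |x|) * max ‖(τ : ℂ)‖ 1 := by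
    calc ‖((x : ℂ) + τ)‖ ≤ ‖(x : ℂ)‖ + ‖(τ : ℂ)‖ := norm_add_le _ _
      _ = |x| + ‖(τ : ℂ)‖ := by rw [Complex.norm_real, Real.norm_eq_abs]
      _ ≤ |x| * max ‖(τ : ℂ)‖ 1 + max ‖(τ : ℂ)‖ 1 :=
          add_le_add (le_mul_of_one_le_right (abs_nonneg x) hb1) (le_max_left _ _)
      _ = (1 + |x|) * max ‖(τ : ℂ)‖ 1 := by ring
  have hmax : max ‖((x : ℂ) + τ)‖ 1 ≤ (1 + |x|) * max ‖(τ : ℂ)‖ 1 :=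
    max_le hx (hb1.trans (le_mul_of_one_le_left (zero_le_one.trans hb1)
      (le_add_of_nonneg_right (abs_nonneg x))))
  calc max τ.im⁻¹ 1 * max ‖((x : ℂ) + τ)‖ 1 ≤ max τ.im⁻¹ 1 * ((1 + |x|) * max ‖(τ : ℂ)‖ 1) :=
        mul_le_mul_of_nonneg_left hmax ha0
    _ = (1 + |x|) * (max τ.im⁻¹ 1 * max ‖(τ : ℂ)‖ 1) := by ring

/-- `Im(τ) ≤ |τ|` on `ℍ`. [folklore] -/
theorem im_le_norm_coe (τ : ℍ) : τ.im ≤ ‖(τ : ℂ)‖ :=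
  (le_abs_self _).trans (abs_im_le_norm (τ : ℂ))

/-- The gauge under `S : τ ↦ −1/τ`: `gauge(−1/τ) ≤ gauge(τ)²`. [folklore] -/
theorem growthGauge_S_smul_le (τ : ℍ) :
    growthGauge (ModularGroup.S • τ) ≤ growthGauge τ ^ 2 := by
  rw [modular_S_smul]
  unfold growthGauge
  set a := max τ.im⁻¹ 1 with ha
  set b := max ‖(τ : ℂ)‖ 1 with hb
  have hy : 0 < τ.im := τ.im_pos
  have hτ0 : (τ : ℂ) ≠ 0 := τ.ne_zero
  have hnorm : 0 < ‖(τ : ℂ)‖ := norm_pos_iff.2 hτ0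
  have ha1 : 1 ≤ a := le_max_right _ _
  have hb1 : 1 ≤ b := le_max_right _ _
  -- imaginary part and norm of `−1/τ`
  have him : (UpperHalfPlane.mk (-(τ : ℂ))⁻¹ τ.im_inv_neg_coe_pos).im = τ.im / ‖(τ : ℂ)‖ ^ 2 := by
    rw [UpperHalfPlane.im, UpperHalfPlane.coe_mk, inv_im, neg_im, normSq_neg, neg_neg,
      UpperHalfPlane.coe_im, Complex.normSq_eq_norm_sq]
  have hno : ‖((UpperHalfPlane.mk (-(τ : ℂ))⁻¹ τ.im_inv_neg_coe_pos : ℍ) : ℂ)‖ = ‖(τ : ℂ)‖⁻¹ := by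
    rw [UpperHalfPlane.coe_mk, norm_inv, norm_neg]
  rw [him, hno]
  -- first factor
  have h1 : max (τ.im / ‖(τ : ℂ)‖ ^ 2)⁻¹ 1 ≤ b ^ 2 * a := by
    refine max_le ?_ ?_
    · rw [inv_div, div_eq_mul_inv]
      exact mul_le_mul (pow_le_pow_left₀ (norm_nonneg _) (le_max_left _ _) 2) (le_max_left _ _)
        (inv_nonneg.2 hy.le) (by positivity)
    · nlinarith [one_le_pow₀ (n := 2) hb1]
  -- second factor
  have h2 : max ‖(τ : ℂ)‖⁻¹ 1 ≤ a :=
    max_le ((inv_anti₀ hy (im_le_norm_coe τ)).trans (le_max_left _ _)) ha1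
  calc max (τ.im / ‖(τ : ℂ)‖ ^ 2)⁻¹ 1 * max ‖(τ : ℂ)‖⁻¹ 1 ≤ (b ^ 2 * a) * a :=
        mul_le_mul h1 h2 (zero_le_one.trans (le_max_right _ _)) (by positivity)
    _ = (a * b) ^ 2 := by ring

/-- The automorphy factor of `S`: `‖τ^{−k}‖ ≤ gauge(τ)^{|k|}`. [folklore] -/
theorem norm_coe_zpow_neg_le (τ : ℍ) (k : ℤ) :
    ‖(τ : ℂ) ^ (-k)‖ ≤ growthGauge τ ^ k.natAbs := by
  have hy : 0 < τ.im := τ.im_pos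
  have hnorm : 0 < ‖(τ : ℂ)‖ := norm_pos_iff.2 τ.ne_zero
  rw [norm_zpow]
  rcases le_total 0 k with hk | hk
  · -- `k ≥ 0`: `‖τ‖^{-k} ≤ (Im τ)^{-k} ≤ gauge^k`
    obtain ⟨n, rfl⟩ := Int.eq_ofNat_of_zero_le hk
    rw [zpow_neg, zpow_natCast, Int.natAbs_natCast, ← inv_pow]
    exact pow_le_pow_left₀ (inv_nonneg.2 hnorm.le)
      ((inv_anti₀ hy (im_le_norm_coe τ)).trans (inv_im_le_growthGauge τ)) n
  · -- `k ≤ 0`: `‖τ‖^{|k|} ≤ gauge^{|k|}`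
    obtain ⟨n, hn⟩ := Int.exists_eq_neg_ofNat hk
    rw [hn, neg_neg, zpow_natCast, Int.natAbs_neg, Int.natAbs_natCast]
    exact pow_le_pow_left₀ hnorm.le (norm_coe_le_growthGauge τ) n

namespace HasModerateGrowth

variable {F : ℍ → ℂ}

/-- Moderate growth is stable under real translations. [folklore] -/
theorem vadd (hF : HasModerateGrowth F) (x : ℝ) : HasModerateGrowth fun τ : ℍ => F (x +ᵥ τ) := by
  obtain ⟨C, N, hC, h⟩ := hF.exists_bound
  refine hasModerateGrowth_of_le (C * (1 + |x|) ^ N) N fun τ => (h _).trans ?_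
  calc C * growthGauge (x +ᵥ τ) ^ N ≤ C * ((1 + |x|) * growthGauge τ) ^ N :=
        mul_le_mul_of_nonneg_left
          (pow_le_pow_left₀ (growthGauge_pos _).le (growthGauge_vadd_le x τ) N) hC
    _ = C * (1 + |x|) ^ N * growthGauge τ ^ N := by rw [mul_pow]; ring

/-- Moderate growth is stable under `|ₖT`. [folklore] -/
theorem slash_T (hF : HasModerateGrowth F) (k : ℤ) :
    HasModerateGrowth (F ∣[k] ModularGroup.T) := by
  have h : F ∣[k] ModularGroup.T = fun τ : ℍ => F ((1 : ℝ) +ᵥ τ) := by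
    ext τ
    rw [SL_slash_apply, modular_T_smul, ModularGroup.denom_apply]
    simp [ModularGroup.T]
  rw [h]
  exact hF.vadd 1

/-- Moderate growth is stable under `|ₖT⁻¹`. [folklore] -/
theorem slash_T_inv (hF : HasModerateGrowth F) (k : ℤ) :
    HasModerateGrowth (F ∣[k] ModularGroup.T⁻¹) := by
  have h : F ∣[k] ModularGroup.T⁻¹ = fun τ : ℍ => F ((-1 : ℝ) +ᵥ τ) := by
    ext τ
    have hsm : ModularGroup.T⁻¹ • τ = (-1 : ℝ) +ᵥ τ := by
      rw [show ModularGroup.T⁻¹ = ModularGroup.T ^ (-1 : ℤ) by simp, modular_T_zpow_smul]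
      simp
    rw [SL_slash_apply, hsm, ModularGroup.denom_apply, ModularGroup.coe_T_inv]
    simp
  rw [h]
  exact hF.vadd (-1)

/-- Moderate growth is stable under `|ₖS`. [folklore] -/
theorem slash_S (hF : HasModerateGrowth F) (k : ℤ) :
    HasModerateGrowth (F ∣[k] ModularGroup.S) := by
  obtain ⟨C, N, hC, h⟩ := hF.exists_bound
  refine hasModerateGrowth_of_le C (2 * N + k.natAbs) fun τ => ?_
  rw [SL_slash_apply, ModularGroup.denom_S, norm_mul]
  calc ‖F (ModularGroup.S • τ)‖ * ‖(τ : ℂ) ^ (-k)‖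
      ≤ (C * growthGauge (ModularGroup.S • τ) ^ N) * growthGauge τ ^ k.natAbs :=
        mul_le_mul (h _) (norm_coe_zpow_neg_le τ k) (norm_nonneg _)
          ((norm_nonneg _).trans (h _))
    _ ≤ (C * (growthGauge τ ^ 2) ^ N) * growthGauge τ ^ k.natAbs :=
        mul_le_mul_of_nonneg_right (mul_le_mul_of_nonneg_left
          (pow_le_pow_left₀ (growthGauge_pos _).le (growthGauge_S_smul_le τ) N) hC)
          (pow_nonneg (growthGauge_pos τ).le _)
    _ = C * growthGauge τ ^ (2 * N + k.natAbs) := by rw [← pow_mul, pow_add]; ring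

/-- Moderate growth is stable under `|ₖS⁻¹` (`S⁻¹ = S³`). [folklore] -/
theorem slash_S_inv (hF : HasModerateGrowth F) (k : ℤ) :
    HasModerateGrowth (F ∣[k] ModularGroup.S⁻¹) := by
  have hS : ModularGroup.S⁻¹ = ModularGroup.S * ModularGroup.S * ModularGroup.S := by
    ext i j
    fin_cases i <;> fin_cases j <;> simp [ModularGroup.S]
  rw [hS, SlashAction.slash_mul, SlashAction.slash_mul]
  exact ((hF.slash_S k).slash_S k).slash_S k

/-- **Moderate growth is preserved by the weight-`k` slash action of `SL₂(ℤ)`** (CKMRV §4.1,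
Lemma 4.1: "In particular, `𝓟` is preserved by the slash operation"). [cite: CohnEtAl2019, §4.1 Lemma 4.1] -/
theorem slash (hF : HasModerateGrowth F) (k : ℤ) (γ : SL(2, ℤ)) :
    HasModerateGrowth (F ∣[k] γ) := by
  have hγ : γ ∈ Subgroup.closure {ModularGroup.S, ModularGroup.T} := by
    simp [SpecialLinearGroup.SL2Z_generators]
  induction hγ using Subgroup.closure_induction'' generalizing F with
  | one => simpa using hF
  | mem g hg =>
    simp only [Set.mem_insert_iff, Set.mem_singleton_iff] at hg
    rcases hg with rfl | rfl
    · exact hF.slash_S k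
    · exact hF.slash_T k
  | inv_mem g hg =>
    simp only [Set.mem_insert_iff, Set.mem_singleton_iff] at hg
    rcases hg with rfl | rfl
    · exact hF.slash_S_inv k
    · exact hF.slash_T_inv k
  | mul g g' _ _ ihg ihg' =>
    rw [SlashAction.slash_mul]
    exact ihg' (ihg hF)

end HasModerateGrowth

/-- **`𝓟` is preserved by the slash action of `SL₂(ℤ)`** (CKMRV Lemma 4.1). [cite: CohnEtAl2019, §4.1 Lemma 4.1] -/
theorem IsClassP.slash {F : ℍ → ℂ} (hF : IsClassP F) (k : ℤ) (γ : SL(2, ℤ)) :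
    IsClassP (F ∣[k] γ) :=
  ⟨hF.1.slash k γ, hF.2.slash k γ⟩

/-! ## Periodic functions bounded at `i∞` are bounded on half-planes `Im τ ≥ A` -/

/-- Iterating `F(τ + 1) = F(τ)`: `F(τ + n) = F(τ)` for `n ∈ ℤ`. [folklore] -/
theorem apply_int_vadd_of_periodic {F : ℍ → ℂ} (hper : ∀ τ : ℍ, F ((1 : ℝ) +ᵥ τ) = F τ)
    (n : ℤ) (τ : ℍ) : F ((n : ℝ) +ᵥ τ) = F τ := by
  induction n using Int.induction_on generalizing τ with
  | zero => simp
  | succ n ih =>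
    have : (((n : ℤ) + 1 : ℤ) : ℝ) +ᵥ τ = (1 : ℝ) +ᵥ (((n : ℤ) : ℝ) +ᵥ τ) := by
      rw [vadd_vadd]; push_cast; ring_nf
    rw [this, hper, ih]
  | pred n ih =>
    have : ((-(n : ℤ) : ℤ) : ℝ) +ᵥ τ = (1 : ℝ) +ᵥ (((-(n : ℤ) - 1 : ℤ) : ℝ) +ᵥ τ) := by
      rw [vadd_vadd]; push_cast; ring_nf
    rw [← ih τ, this, hper]

/-- **A continuous `1`-periodic function on `ℍ` bounded at `i∞` is bounded on every half-plane
`Im τ ≥ A > 0`** (compactness of the box `[0,1] × [A, A₁]`). [folklore] -/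
theorem exists_bound_of_periodic {F : ℍ → ℂ} (hcont : Continuous F)
    (hper : ∀ τ : ℍ, F ((1 : ℝ) +ᵥ τ) = F τ) (hbdd : IsBoundedAtImInfty F) {A : ℝ} (hA : 0 < A) :
    ∃ M : ℝ, ∀ τ : ℍ, A ≤ τ.im → ‖F τ‖ ≤ M := by
  obtain ⟨M₁, A₁, hM₁⟩ := isBoundedAtImInfty_iff.1 hbdd
  set B : ℝ := max A A₁ with hB
  -- the compact box
  set K : Set ℂ := Set.Icc (0 : ℝ) 1 ×ℂ Set.Icc A B with hK
  have hKc : IsCompact K := isCompact_Icc.reProdIm isCompact_Icc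
  have hKsub : K ⊆ Set.range ((↑) : ℍ → ℂ) := by
    intro z hz
    have hz' : 0 < z.im := hA.trans_le (mem_reProdIm.1 hz).2.1
    exact ⟨⟨z, hz'⟩, rfl⟩
  have hGK : ContinuousOn (F ∘ ofComplex) K := by
    refine hcont.comp_continuousOn (ofComplex.continuousOn.mono ?_)
    intro z hz
    simpa [ofComplex] using hKsub hz
  obtain ⟨M₂, hM₂⟩ := hKc.exists_bound_of_continuousOn hGK
  refine ⟨max M₁ M₂, fun τ hτ => ?_⟩
  rcases le_total A₁ τ.im with h₁ | h₁
  · exact (hM₁ τ h₁).trans (le_max_left _ _)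
  · -- translate `τ` into the box
    set n : ℤ := ⌊τ.re⌋ with hn
    set τ₀ : ℍ := ((-n : ℤ) : ℝ) +ᵥ τ with hτ₀
    have hF : F τ₀ = F τ := apply_int_vadd_of_periodic hper (-n) τ
    have hmem : (τ₀ : ℂ) ∈ K := by
      refine mem_reProdIm.2 ⟨?_, ?_⟩
      · rw [coe_re, hτ₀, vadd_re]
        push_cast
        constructor
        · linarith [Int.floor_le τ.re]
        · linarith [Int.lt_floor_add_one τ.re]
      · rw [coe_im, hτ₀, vadd_im]
        exact ⟨hτ, h₁.trans (le_max_right _ _)⟩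
    have := hM₂ _ hmem
    rw [Function.comp_apply, ofComplex_apply, hF] at this
    exact this.trans (le_max_right _ _)

/-! ## Level-one modular forms have moderate growth -/

/-- `‖cτ + d‖ ≥ min(1, Im τ)` for the bottom row `(c, d)` of a matrix in `SL₂(ℤ)`. [folklore] -/
theorem min_one_im_le_norm_denom (γ : SL(2, ℤ)) (τ : ℍ) :
    min 1 τ.im ≤ ‖denom (γ : GL (Fin 2) ℝ) τ‖ := by
  rw [ModularGroup.denom_apply]
  by_cases hc : γ 1 0 = 0
  · -- `c = 0`: then `a d = 1`, so `|d| = 1`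
    have hdet := Matrix.det_fin_two (γ : Matrix (Fin 2) (Fin 2) ℤ)
    rw [γ.det_coe, hc, mul_zero, sub_zero] at hdet
    have hd : (γ 1 1 : ℤ) = 1 ∨ (γ 1 1 : ℤ) = -1 :=
      Int.eq_one_or_neg_one_of_mul_eq_one' hdet.symm |>.imp (fun h => h.2) (fun h => h.2)
    have : ‖((γ 1 0 : ℤ) : ℂ) * (τ : ℂ) + ((γ 1 1 : ℤ) : ℂ)‖ = 1 := by
      rcases hd with h | h <;> simp [hc, h]
    rw [this]
    exact min_le_left _ _
  · -- `c ≠ 0`: `‖cτ + d‖ ≥ |Im(cτ + d)| = |c| Im τ ≥ Im τ`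
    have hc1 : (1 : ℝ) ≤ |((γ 1 0 : ℤ) : ℝ)| := by
      rw [← Int.cast_abs]
      exact_mod_cast Int.one_le_abs hc
    calc min 1 τ.im ≤ τ.im := min_le_right _ _
      _ ≤ |((γ 1 0 : ℤ) : ℝ)| * τ.im := le_mul_of_one_le_left τ.im_pos.le hc1
      _ = |(((γ 1 0 : ℤ) : ℂ) * (τ : ℂ) + ((γ 1 1 : ℤ) : ℂ)).im| := by
          simp [Complex.add_im, Complex.mul_im, abs_mul, abs_of_pos τ.im_pos]
      _ ≤ ‖((γ 1 0 : ℤ) : ℂ) * (τ : ℂ) + ((γ 1 1 : ℤ) : ℂ)‖ := abs_im_le_norm _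

/-- `(min(1, Im τ))⁻¹ ≤ gauge(τ)`. [folklore] -/
theorem inv_min_one_im_le_growthGauge (τ : ℍ) : (min 1 τ.im)⁻¹ ≤ growthGauge τ := by
  rcases le_total 1 τ.im with h | h
  · rw [min_eq_left h, inv_one]; exact one_le_growthGauge τ
  · rw [min_eq_right h]; exact inv_im_le_growthGauge τ

/-- **Every modular form of level one has moderate growth**: `‖f(τ)‖ ≤ M(1 + Im(τ)^{−k})`
(reduce to `Im(γτ) ≥ 1/2`, where `f` is bounded by periodicity, continuity and boundedness at
`i∞`, and use `f(τ) = (cτ+d)^{−k} f(γτ)` with `|cτ+d| ≥ min(1, Im τ)`). CKMRV §4.1: "(4.1) … is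
satisfied by … the classical modular forms `E_k`". [cite: CohnEtAl2019, §4.1] -/
theorem hasModerateGrowth_of_modularForm {k : ℤ} {F : Type*} [FunLike F ℍ ℂ]
    [ModularFormClass F 𝒮ℒ k] (f : F) : HasModerateGrowth (f : ℍ → ℂ) := by
  rcases lt_or_ge k 0 with hk | hk
  · rw [ModularFormClass.levelOne_neg_weight_eq_zero hk f]
    exact hasModerateGrowth_zero
  · -- periodicity and a bound on `Im ≥ 1/2`
    have hΓ1 : SlashInvariantFormClass F (CongruenceSubgroup.Gamma 1) k :=
      CongruenceSubgroup.Gamma_one_coe_eq_SL ▸ (inferInstance : SlashInvariantFormClass F 𝒮ℒ k)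
    have heqn : ∀ (γ : SL(2, ℤ)) (τ : ℍ), f (γ • τ) = denom (γ : GL (Fin 2) ℝ) τ ^ k * f τ :=
      fun γ τ => slash_action_eqn_SL'' f (CongruenceSubgroup.mem_Gamma_one γ) τ
    have hper : ∀ τ : ℍ, f ((1 : ℝ) +ᵥ τ) = f τ := fun τ => by
      have := heqn ModularGroup.T τ
      rw [modular_T_smul, ModularGroup.denom_apply] at this
      simpa [ModularGroup.T] using this
    obtain ⟨M, hM⟩ := exists_bound_of_periodic (ModularFormClass.holo f).continuous hper
      (ModularFormClass.bdd_at_infty f) one_half_pos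
    have hM0 : 0 ≤ M := (norm_nonneg _).trans (hM UpperHalfPlane.I (by norm_num))
    obtain ⟨n, rfl⟩ := Int.eq_ofNat_of_zero_le hk
    refine hasModerateGrowth_of_le M n fun τ => ?_
    obtain ⟨γ, hγ⟩ := ModularGroup.exists_one_half_le_im_smul τ
    have h := heqn γ τ
    have hd : min 1 τ.im ≤ ‖denom (γ : GL (Fin 2) ℝ) τ‖ := min_one_im_le_norm_denom γ τ
    have hmin : 0 < min 1 τ.im := lt_min one_pos τ.im_pos
    have hd0 : 0 < ‖denom (γ : GL (Fin 2) ℝ) τ‖ := hmin.trans_le hd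
    have hnorm : ‖f (γ • τ)‖ = ‖denom (γ : GL (Fin 2) ℝ) τ‖ ^ n * ‖f τ‖ := by
      rw [h, norm_mul, zpow_natCast, norm_pow]
    have hfτ : ‖f τ‖ = ‖f (γ • τ)‖ * (‖denom (γ : GL (Fin 2) ℝ) τ‖ ^ n)⁻¹ := by
      rw [hnorm]; field_simp
    rw [hfτ]
    calc ‖f (γ • τ)‖ * (‖denom (γ : GL (Fin 2) ℝ) τ‖ ^ n)⁻¹ ≤ M * ((min 1 τ.im) ^ n)⁻¹ :=
          mul_le_mul (hM _ hγ) (inv_anti₀ (pow_pos hmin n) (pow_le_pow_left₀ hmin.le hd n))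
            (inv_nonneg.2 (pow_nonneg (norm_nonneg _) n)) hM0
      _ = M * ((min 1 τ.im)⁻¹) ^ n := by rw [inv_pow]
      _ ≤ M * growthGauge τ ^ n := mul_le_mul_of_nonneg_left
          (pow_le_pow_left₀ (inv_nonneg.2 hmin.le) (inv_min_one_im_le_growthGauge τ) n) hM0

/-- Level-one modular forms are in `𝓟`. [cite: CohnEtAl2019, §4.1] -/
theorem isClassP_of_modularForm {k : ℤ} {F : Type*} [FunLike F ℍ ℂ] [ModularFormClass F 𝒮ℒ k]
    (f : F) : IsClassP (f : ℍ → ℂ) :=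
  ⟨ModularFormClass.holo f, hasModerateGrowth_of_modularForm f⟩

/-- `E_k ∈ 𝓟` (`k ≥ 3`; in particular `E₄`, `E₆`). [cite: CohnEtAl2019, §4.1] -/
theorem isClassP_E {k : ℕ} (hk : 3 ≤ k) : IsClassP (ModularForm.E hk) :=
  isClassP_of_modularForm _

/-- `Δ ∈ 𝓟`. [cite: CohnEtAl2019, §4.1] -/
theorem isClassP_discriminant : IsClassP ModularForm.discriminant := by
  simpa using isClassP_of_modularForm CuspForm.discriminant

/-! ## `E₂` has moderate growth -/

/-- `|c| Im τ ≤ ‖cτ + d‖` for the bottom row `(c, d)` of a matrix in `SL₂(ℤ)`. [folklore] -/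
theorem abs_mul_im_le_norm_denom (γ : SL(2, ℤ)) (τ : ℍ) :
    |((γ 1 0 : ℤ) : ℝ)| * τ.im ≤ ‖denom (γ : GL (Fin 2) ℝ) τ‖ := by
  rw [ModularGroup.denom_apply]
  calc |((γ 1 0 : ℤ) : ℝ)| * τ.im = |(((γ 1 0 : ℤ) : ℂ) * (τ : ℂ) + ((γ 1 1 : ℤ) : ℂ)).im| := by
        simp [Complex.add_im, Complex.mul_im, abs_mul, abs_of_pos τ.im_pos]
    _ ≤ ‖((γ 1 0 : ℤ) : ℂ) * (τ : ℂ) + ((γ 1 1 : ℤ) : ℂ)‖ := abs_im_le_norm _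

/-- The correction term of `E₂`: `‖D₂(γ)(τ)‖ = 2π|c|/|cτ + d| ≤ 2π / Im τ`. [folklore] -/
theorem norm_D2_le (γ : SL(2, ℤ)) (τ : ℍ) : ‖EisensteinSeries.D2 γ τ‖ ≤ 2 * π * τ.im⁻¹ := by
  rw [EisensteinSeries.D2, norm_div]
  by_cases hc : γ 1 0 = 0
  · simp [hc]
    positivity
  · have hd0 : 0 < ‖denom (γ : GL (Fin 2) ℝ) τ‖ := norm_pos_iff.2 (denom_ne_zero _ _)
    have hcpos : 0 < |((γ 1 0 : ℤ) : ℝ)| := by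
      rw [← Int.cast_abs]; exact_mod_cast Int.one_le_abs hc
    rw [div_le_iff₀ hd0]
    have hnum : ‖2 * (π : ℂ) * I * ((γ 1 0 : ℤ) : ℂ)‖ = 2 * π * |((γ 1 0 : ℤ) : ℝ)| := by
      have : (2 * (π : ℂ) * I * ((γ 1 0 : ℤ) : ℂ)) = ((2 * π * ((γ 1 0 : ℤ) : ℝ) : ℝ) : ℂ) * I := by
        push_cast; ring
      rw [this, norm_mul, Complex.norm_I, mul_one, Complex.norm_real, Real.norm_eq_abs, abs_mul,
        abs_mul, abs_two, abs_of_pos Real.pi_pos]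
    rw [hnum]
    have h := abs_mul_im_le_norm_denom γ τ
    calc 2 * π * |((γ 1 0 : ℤ) : ℝ)| = 2 * π * τ.im⁻¹ * (|((γ 1 0 : ℤ) : ℝ)| * τ.im) := by
          field_simp
      _ ≤ 2 * π * τ.im⁻¹ * ‖denom (γ : GL (Fin 2) ℝ) τ‖ := by gcongr

/-- `E₂` is `1`-periodic. [folklore] -/
theorem E2_vadd_one (τ : ℍ) : EisensteinSeries.E2 ((1 : ℝ) +ᵥ τ) = EisensteinSeries.E2 τ := by
  have h := congrFun (EisensteinSeries.E2_slash_action ModularGroup.T) τ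
  rw [EisensteinSeries.D2_T, smul_zero, sub_zero, SL_slash_apply, modular_T_smul,
    ModularGroup.denom_apply] at h
  simpa [ModularGroup.T] using h

/-- **`E₂` has moderate growth**: from `E₂(τ) = (cτ+d)^{−2}E₂(γτ) + (2ζ(2))^{−1}D₂(γ)(τ)` with
`Im(γτ) ≥ 1/2`, `|cτ + d| ≥ min(1, Im τ)` and `|D₂(γ)(τ)| ≤ 2π/Im τ`. [cite: CohnEtAl2019, §4.1] -/
theorem hasModerateGrowth_E2 : HasModerateGrowth EisensteinSeries.E2 := by
  obtain ⟨M, hM⟩ := exists_bound_of_periodic E2_mdifferentiable.continuous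
    E2_vadd_one EisensteinSeries.isBoundedAtImInfty_E2 one_half_pos
  have hM0 : 0 ≤ M := (norm_nonneg _).trans (hM UpperHalfPlane.I (by norm_num))
  set c₀ : ℂ := 1 / (2 * riemannZeta 2) with hc₀
  refine hasModerateGrowth_of_le (M + ‖c₀‖ * (2 * π)) 2 fun τ => ?_
  obtain ⟨γ, hγ⟩ := ModularGroup.exists_one_half_le_im_smul τ
  have h := congrFun (EisensteinSeries.E2_slash_action γ) τ
  rw [SL_slash_apply, Pi.sub_apply, Pi.smul_apply, smul_eq_mul] at h
  -- `E₂ τ = E₂(γτ) (cτ+d)^{-2} + c₀ D₂ γ τ`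
  have hE : EisensteinSeries.E2 τ =
      EisensteinSeries.E2 (γ • τ) * denom (γ : GL (Fin 2) ℝ) τ ^ (-2 : ℤ) +
        c₀ * EisensteinSeries.D2 γ τ := by
    rw [h]; ring
  have hmin : 0 < min 1 τ.im := lt_min one_pos τ.im_pos
  have hd : min 1 τ.im ≤ ‖denom (γ : GL (Fin 2) ℝ) τ‖ := min_one_im_le_norm_denom γ τ
  have hden : ‖denom (γ : GL (Fin 2) ℝ) τ ^ (-2 : ℤ)‖ ≤ growthGauge τ ^ 2 := by
    rw [norm_zpow, zpow_neg, zpow_ofNat, ← inv_pow]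
    exact pow_le_pow_left₀ (inv_nonneg.2 (norm_nonneg _))
      ((inv_anti₀ hmin hd).trans (inv_min_one_im_le_growthGauge τ)) 2
  have hD : ‖EisensteinSeries.D2 γ τ‖ ≤ 2 * π * growthGauge τ ^ 2 := by
    refine (norm_D2_le γ τ).trans (mul_le_mul_of_nonneg_left ?_ (by positivity))
    calc τ.im⁻¹ ≤ growthGauge τ := inv_im_le_growthGauge τ
      _ ≤ growthGauge τ ^ 2 := le_self_pow₀ (one_le_growthGauge τ) two_ne_zero
  rw [hE]
  calc ‖EisensteinSeries.E2 (γ • τ) * denom (γ : GL (Fin 2) ℝ) τ ^ (-2 : ℤ) +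
        c₀ * EisensteinSeries.D2 γ τ‖
      ≤ ‖EisensteinSeries.E2 (γ • τ)‖ * ‖denom (γ : GL (Fin 2) ℝ) τ ^ (-2 : ℤ)‖ +
        ‖c₀‖ * ‖EisensteinSeries.D2 γ τ‖ := by
        refine (norm_add_le _ _).trans ?_
        rw [norm_mul, norm_mul]
    _ ≤ M * growthGauge τ ^ 2 + ‖c₀‖ * (2 * π * growthGauge τ ^ 2) :=
        add_le_add (mul_le_mul (hM _ hγ) hden (norm_nonneg _) hM0)
          (mul_le_mul_of_nonneg_left hD (norm_nonneg _))
    _ = (M + ‖c₀‖ * (2 * π)) * growthGauge τ ^ 2 := by ring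

/-- **`E₂ ∈ 𝓟`.** [cite: CohnEtAl2019, §4.1] -/
theorem isClassP_E2 : IsClassP EisensteinSeries.E2 :=
  ⟨E2_mdifferentiable, hasModerateGrowth_E2⟩

end Literature.NumberTheory.ModularForms
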